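import Literature.NumberTheory.Sieve.FriedlanderIwaniecPrimesThresholdSeparation
import Literature.NumberTheory.Sieve.FriedlanderIwaniecPrimesDirichletBilinearGeneral
import Literature.NumberTheory.Sieve.FriedlanderIwaniecPrimesLinearForms
import HarnessLib

/-!
# Friedlander–Iwaniec, *The polynomial `X² + Y⁴` captures its primes*, §21: Proposition 21.4 — bilinear forms in Jacobi–Kubota symbols

Family `parity` (rung F-SPIN). Source: J. Friedlander, H. Iwaniec, Ann. of Math. (2) 148 (1998),
945–1040 [FriedlanderIwaniecAnnals1998] (= arXiv:math/9811185), §21 (21.11)–(21.13):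

"Our actual goal is to estimate bilinear forms in the Jacobi-Kubota symbol `[wz]` (see (20.1)) rather
than in the Dirichlet symbol `(z/w)` (see (19.10)). However, by virtue of the multiplier rule (20.3)
together with the formula (20.15) and the Fourier series (20.19) these problems are essentially
equivalent as long as the coefficients `α_w, β_z` are arbitrary but bounded. We denote
(21.11) `𝒦(M, N) = Σ_w Σ_z α_w β_z [wz]` where `α_w, β_z` are complex coefficients supported on
primary numbers in the discs (21.2), (21.3) respectively. …
PROPOSITION 21.4. … (21.13) `𝒦(M, N) ≪ (M + N)^{1/12} (MN)^{11/12+ε}` where the implied constant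
depends only on `ε`. … *Proof.* By Proposition 21.3 (without loss of generality one can restrict `w`
and `z` to primitive numbers because otherwise `[wz]` vanishes) we at once obtain (21.13)."

## The proof formalised

This file PROVES (21.13) for `𝒦(M, N)` (the restricted form `𝒦*` is not needed downstream and is not
treated). "At once" unfolds as follows. For `w = u + iv` primary primitive with `v ≠ 0` and
`z = r + is` primary, Lemma 20.1 [tree: `jacobiKubota_mul`] gives `[wz] = ε(w,z) [w] [z] (z/w)` with
`ε(w, z) = kubotaEps u v r s`, a function of the signs of `u, v, r` and of `sign(Re wz) = sign(ur - vs)`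
only (`kubotaEps_eq_epsSign`). Since `ur - vs = vr (u/v - s/r)`,
`sign(ur - vs) = sign v · sign r · (1 - 2·[u/v < s/r])` (`sign_re_mul_eq`): the only coupling of
`w` and `z` in `ε` is the THRESHOLD `[B(w) < A(z)]`, `B(w) = u/v`, `A(z) = s/r`, with
`1/(2MN) ≤ |A(z) - B(w)| ≤ 2MN`. The threshold is separated by `BilinBoundedBy.threshold`
(Fourier transform of the trapezoid of Lemma 26.1, cost `3(1 + log 2MN)`; this replaces the Fourier
series (20.16)–(20.19) of the source, same principle), after which Proposition 21.3
[tree: `norm_dirichletBilin_disc_le`] applies to each of the `8` resulting twisted forms. The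
primary primitive `w` with `v = 0` is `w = 1`, contributing at most `#{z} ≤ 9N`; non-primitive `w`
contribute nothing. The logarithm is absorbed into `ε`.

Main result: `norm_kubotaBilin_le` — for every `ε > 0` a `C` with
`‖Σ_{w} Σ_{z} α_w β_z [wz]‖ ≤ C (M+N)^{1/12} (MN)^{11/12+ε}` for all `M, N ≥ 1` and all
`|α|, |β| ≤ 1`, the sums over primary `w, z` with `1 ≤ |w|² ≤ M`, `1 ≤ |z|² ≤ N`.

## References

* J. Friedlander, H. Iwaniec, Ann. of Math. (2) 148 (1998), 945–1040, §20 Lemma 20.1, (20.15);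
  §21 Proposition 21.3 (21.10), Proposition 21.4 (21.11)–(21.13). [FriedlanderIwaniecAnnals1998]

## Tree / Mathlib

Tree: `BilinBoundedBy`, `BilinBoundedBy.threshold`, `BilinBoundedBy.twist` (`…ThresholdSeparation`),
`norm_dirichletBilin_disc_le`, `dirichletBilin_def`, `gaussDisc`, `mem_gaussDisc` (`…DirichletBilinearGeneral`),
`ppDisc`, `mem_ppDisc`, `card_le_of_norm_le`, `sq_two_sqrt_add_one_le` (`…DirichletBilinearBound`),
`jacobiKubota_mul`, `kubotaEps`, `hilbertInfty`, `hilbertInfty_congr`, `jacobiKubota_eq_zero_of_not_isPrimitive`,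
`eq_one_of_isPrimary_of_im_eq_zero` (`…JacobiKubota`), `dirichletSym`, `re_odd_of_isPrimary`,
`not_natCast_dvd_of_isPrimitive` (`…DirichletSymbol`), `primaryNormLE`, `mem_primaryNormLE`,
`norm_jacobiKubota_le_one` (`…LinearForms`). Mathlib: `Int.sign_*`, `Real.log_le_rpow_div`, `Real.rpow_*`.
-/

noncomputable section

open Finset Real
open scoped NumberTheorySymbols

namespace Literature.NumberTheory.Sieve.FriedlanderIwaniecPrimes

open Literature.NumberTheory.QuadraticFields Literature.NumberTheory.QuadraticFields.GaussianPrimary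
open Literature.NumberTheory.LFunctions.GaussianInt (IsPrimitive)

/-! ### More on `BilinBoundedBy` -/

section API

variable {ι κ : Type*}

/-- Restriction of the (21.13)-type predicate to smaller index sets (extend the coefficients by `0`).
[cite: FriedlanderIwaniecAnnals1998, (21.13)] -/
theorem BilinBoundedBy.restrict [DecidableEq ι] [DecidableEq κ] {K : ι → κ → ℂ} {W W' : Finset ι}
    {Z Z' : Finset κ} {X : ℝ} (h : BilinBoundedBy K W Z X) (hW : W' ⊆ W) (hZ : Z' ⊆ Z) :
    BilinBoundedBy K W' Z' X := by
  intro a b ha hb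
  have := h (fun w => if w ∈ W' then a w else 0) (fun z => if z ∈ Z' then b z else 0)
    (fun w => by split_ifs; exacts [ha w, by simp]) (fun z => by split_ifs; exacts [hb z, by simp])
  have hs : ∑ w ∈ W, ∑ z ∈ Z, (if w ∈ W' then a w else 0) * (if z ∈ Z' then b z else 0) * K w z =
      ∑ w ∈ W', ∑ z ∈ Z', a w * b z * K w z := by
    rw [← sum_subset hW (fun w _ hw => by simp [hw])]
    refine sum_congr rfl fun w hw => ?_
    rw [if_pos hw, ← sum_subset hZ (fun z _ hz => by simp [hz])]
    exact sum_congr rfl fun z hz => by rw [if_pos hz]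
  rw [hs] at this
  exact this

/-- The reversed threshold `[A z < B w]` costs the same factor `3(1 + log R)`.
[cite: FriedlanderIwaniecAnnals1998, Proposition 21.4 (proof)] -/
theorem BilinBoundedBy.threshold' {K : ι → κ → ℂ} {W : Finset ι} {Z : Finset κ} {X : ℝ}
    (h : BilinBoundedBy K W Z X) {A : κ → ℝ} {B : ι → ℝ} {R : ℝ} (hR : 1 ≤ R)
    (hgap : ∀ w ∈ W, ∀ z ∈ Z, 1 / R ≤ |A z - B w|) (hsize : ∀ w ∈ W, ∀ z ∈ Z, |A z - B w| ≤ R) :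
    BilinBoundedBy (fun w z => (if A z < B w then (1 : ℂ) else 0) * K w z) W Z
      (3 * (1 + Real.log R) * X) := by
  have h' := h.threshold (A := fun z => -A z) (B := fun w => -B w) hR
    (fun w hw z hz => by rw [show -A z - -B w = -(A z - B w) by ring, abs_neg]; exact hgap w hw z hz)
    (fun w hw z hz => by rw [show -A z - -B w = -(A z - B w) by ring, abs_neg]; exact hsize w hw z hz)
  intro a b ha hb
  have hs : ∑ w ∈ W, ∑ z ∈ Z, a w * b z * ((if A z < B w then (1 : ℂ) else 0) * K w z) =
      ∑ w ∈ W, ∑ z ∈ Z, a w * b z * ((if -B w < -A z then (1 : ℂ) else 0) * K w z) := by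
    simp only [neg_lt_neg_iff]
  rw [hs]
  exact h' a b ha hb

end API

/-! ### Proposition 21.3 in the `BilinBoundedBy` format -/

/-- **Proposition 21.3 (21.10)** [tree: `norm_dirichletBilin_disc_le`] as a `BilinBoundedBy` statement for
the kernel `(z/w)` over `w` primary primitive with `|w|² ≤ M` and `|z|² ≤ N`.
[cite: FriedlanderIwaniecAnnals1998, Proposition 21.3 (21.10)] -/
theorem bilinBoundedBy_dirichletSym {ε : ℝ} (hε : 0 < ε) :
    ∃ C : ℝ, 0 < C ∧ ∀ M N : ℕ, 1 ≤ M → 1 ≤ N →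
      BilinBoundedBy (fun w z => (dirichletSym z w : ℂ)) (ppDisc M) (gaussDisc N)
        (C * ((M : ℝ) + N) ^ (1 / 12 : ℝ) * ((M : ℝ) * N) ^ (11 / 12 + ε)) := by
  obtain ⟨C, hC, h⟩ := norm_dirichletBilin_disc_le hε
  refine ⟨C, hC, fun M N hM hN a b ha hb => ?_⟩
  have := h M N hM hN a b ha hb
  rwa [dirichletBilin_def] at this

/-! ### The sign `ε(w, z)` as a function of signs -/

/-- `ε` of (20.5)–(20.6) as a function of the four signs `sign u`, `sign v`, `sign r`, `sign(ur - vs)`.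
[cite: FriedlanderIwaniecAnnals1998, (20.5)–(20.6)] -/
def epsSign (σu σv σr σa : ℤ) : ℤ :=
  if 0 < σa then hilbertInfty σu σv * hilbertInfty σr (-σv)
  else hilbertInfty σu σv * hilbertInfty (-σr) σv

/-- Unfolding `epsSign`. [cite: FriedlanderIwaniecAnnals1998, (20.5)–(20.6)] -/
theorem epsSign_def (σu σv σr σa : ℤ) : epsSign σu σv σr σa =
    if 0 < σa then hilbertInfty σu σv * hilbertInfty σr (-σv)
    else hilbertInfty σu σv * hilbertInfty (-σr) σv := rfl

/-- `sign x < 0 ↔ x < 0`. [folklore] -/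
private theorem sign_lt_zero_iff (x : ℤ) : Int.sign x < 0 ↔ x < 0 := by
  rcases lt_trichotomy x 0 with h | rfl | h
  · rw [Int.sign_eq_neg_one_iff_neg.mpr h]; exact ⟨fun _ => h, fun _ => by norm_num⟩
  · simp
  · rw [Int.sign_eq_one_iff_pos.mpr h]; constructor <;> intro h' <;> linarith

/-- `0 < sign x ↔ 0 < x`. [folklore] -/
private theorem sign_pos_iff (x : ℤ) : 0 < Int.sign x ↔ 0 < x := by
  rcases lt_trichotomy x 0 with h | rfl | h
  · rw [Int.sign_eq_neg_one_iff_neg.mpr h]; constructor <;> intro h' <;> linarith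
  · simp
  · rw [Int.sign_eq_one_iff_pos.mpr h]; exact ⟨fun _ => h, fun _ => by norm_num⟩

/-- **`ε(w, z)` depends only on the signs of `u, v, r` and `Re wz`** ("`ε = ±1` depends only on the
quadrants in which `w, z` and `wz` are located"). [cite: FriedlanderIwaniecAnnals1998, Lemma 20.1] -/
theorem kubotaEps_eq_epsSign (u v r s : ℤ) :
    kubotaEps u v r s = epsSign (Int.sign u) (Int.sign v) (Int.sign r) (Int.sign (u * r - v * s)) := by
  have huv : hilbertInfty u v = hilbertInfty (Int.sign u) (Int.sign v) :=
    hilbertInfty_congr (sign_lt_zero_iff u).symm (sign_lt_zero_iff v).symm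
  have hrv : hilbertInfty r (-v) = hilbertInfty (Int.sign r) (-Int.sign v) :=
    hilbertInfty_congr (sign_lt_zero_iff r).symm (by rw [← Int.sign_neg]; exact (sign_lt_zero_iff (-v)).symm)
  have hrv' : hilbertInfty (-r) v = hilbertInfty (-Int.sign r) (Int.sign v) :=
    hilbertInfty_congr (by rw [← Int.sign_neg]; exact (sign_lt_zero_iff (-r)).symm) (sign_lt_zero_iff v).symm
  unfold kubotaEps epsSign
  by_cases ha : 0 < u * r - v * s
  · rw [if_pos ha, if_pos ((sign_pos_iff _).mpr ha), huv, hrv]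
  · rw [if_neg ha, if_neg (fun h => ha ((sign_pos_iff _).mp h)), huv, hrv']

/-- `|(x, y)_∞| = 1`. [folklore] -/
private theorem abs_hilbertInfty_eq_one (x y : ℤ) : |hilbertInfty x y| = 1 := by
  unfold hilbertInfty; split_ifs <;> simp

/-- `‖epsSign‖ = 1` as a complex number. [folklore] -/
private theorem norm_epsSign (a b c e : ℤ) : ‖((epsSign a b c e : ℤ) : ℂ)‖ = 1 := by
  rw [Complex.norm_intCast, ← Int.cast_abs]
  have : |epsSign a b c e| = 1 := by
    unfold epsSign; split_ifs <;> rw [abs_mul, abs_hilbertInfty_eq_one, abs_hilbertInfty_eq_one, mul_one]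
  rw [this]; norm_num

/-! ### `sign(Re wz)` as a threshold in `u/v` and `s/r` -/

/-- `sign v · sign v = 1` for `v ≠ 0`. [folklore] -/
private theorem sign_mul_self {v : ℤ} (hv : v ≠ 0) : Int.sign v * Int.sign v = 1 := by
  rcases lt_or_gt_of_ne hv with h | h
  · rw [Int.sign_eq_neg_one_iff_neg.mpr h]; norm_num
  · rw [Int.sign_eq_one_iff_pos.mpr h]; norm_num

/-- **The coupling of `w` and `z` in `ε(w, z)` is a threshold**: for `v, r ≠ 0` and `ur ≠ vs`,
`sign(ur - vs) = sign v · sign r · (1 - 2 [u/v < s/r])` (as `ur - vs = vr (u/v - s/r)`).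
[cite: FriedlanderIwaniecAnnals1998, (20.15)] -/
theorem sign_re_mul_eq {u v r s : ℤ} (hv : v ≠ 0) (hr : r ≠ 0) (ha : u * r - v * s ≠ 0) :
    Int.sign (u * r - v * s) =
      Int.sign v * Int.sign r * (1 - 2 * (if (u : ℝ) / v < (s : ℝ) / r then 1 else 0)) := by
  have hv' : (v : ℝ) ≠ 0 := by exact_mod_cast hv
  have hr' : (r : ℝ) ≠ 0 := by exact_mod_cast hr
  set a : ℤ := u * r - v * s with ha_def
  set σ : ℤ := Int.sign v * Int.sign r with hσ
  have hσσ : σ * σ = 1 := by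
    rw [hσ, show Int.sign v * Int.sign r * (Int.sign v * Int.sign r) =
      (Int.sign v * Int.sign v) * (Int.sign r * Int.sign r) by ring, sign_mul_self hv, sign_mul_self hr, mul_one]
  have hkey : (u : ℝ) / v - (s : ℝ) / r = (a : ℝ) / ((v * r : ℤ) : ℝ) := by
    rw [ha_def]; push_cast; field_simp
  have hsignprod : Int.sign (a * (v * r)) = Int.sign a * σ := by rw [Int.sign_mul, Int.sign_mul, hσ]
  split_ifs with hlt
  · -- `u/v < s/r`: `a (vr) < 0`
    have hneg : (a : ℝ) / ((v * r : ℤ) : ℝ) < 0 := by rw [← hkey]; linarith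
    have hneg' : a * (v * r) < 0 := by
      rcases div_neg_iff.mp hneg with ⟨h1, h2⟩ | ⟨h1, h2⟩
      · exact mul_neg_of_pos_of_neg (by exact_mod_cast h1) (by exact_mod_cast h2)
      · exact mul_neg_of_neg_of_pos (by exact_mod_cast h1) (by exact_mod_cast h2)
    have hs : Int.sign a * σ = -1 := by rw [← hsignprod]; exact Int.sign_eq_neg_one_iff_neg.mpr hneg'
    calc Int.sign a = Int.sign a * (σ * σ) := by rw [hσσ, mul_one]
      _ = (Int.sign a * σ) * σ := by ring
      _ = σ * (1 - 2 * 1) := by rw [hs]; ring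
  · -- `u/v > s/r`: `a (vr) > 0`
    have hne : (u : ℝ) / v - (s : ℝ) / r ≠ 0 := by
      rw [hkey]
      exact div_ne_zero (by exact_mod_cast ha) (by exact_mod_cast mul_ne_zero hv hr)
    have hpos : 0 < (a : ℝ) / ((v * r : ℤ) : ℝ) := by
      rw [← hkey]
      rcases lt_or_gt_of_ne (sub_ne_zero.mp hne) with h | h
      · exact absurd h hlt
      · linarith
    have hpos' : 0 < a * (v * r) := by
      rcases div_pos_iff.mp hpos with ⟨h1, h2⟩ | ⟨h1, h2⟩
      · exact mul_pos (by exact_mod_cast h1) (by exact_mod_cast h2)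
      · exact mul_pos_of_neg_of_neg (by exact_mod_cast h1) (by exact_mod_cast h2)
    have hs : Int.sign a * σ = 1 := by rw [← hsignprod]; exact Int.sign_eq_one_iff_pos.mpr hpos'
    calc Int.sign a = Int.sign a * (σ * σ) := by rw [hσσ, mul_one]
      _ = (Int.sign a * σ) * σ := by ring
      _ = σ * (1 - 2 * 0) := by rw [hs]; ring

/-- **The spacing of the threshold**: for integers `u, v, r, s` with `v, r ≠ 0`, `ur ≠ vs`,
`u², v² ≤ M`, `r², s² ≤ N`: `1/(2MN) ≤ |s/r - u/v| ≤ 2MN`. [cite: FriedlanderIwaniecAnnals1998, (20.18)] -/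
theorem threshold_gap {u v r s : ℤ} {M N : ℕ} (hv : v ≠ 0) (hr : r ≠ 0) (ha : u * r - v * s ≠ 0)
    (huM : u ^ 2 ≤ M) (hvM : v ^ 2 ≤ M) (hrN : r ^ 2 ≤ N) (hsN : s ^ 2 ≤ N) :
    1 / (2 * (M : ℝ) * N) ≤ |(s : ℝ) / r - (u : ℝ) / v| ∧
      |(s : ℝ) / r - (u : ℝ) / v| ≤ 2 * (M : ℝ) * N := by
  have hv' : (v : ℝ) ≠ 0 := by exact_mod_cast hv
  have hr' : (r : ℝ) ≠ 0 := by exact_mod_cast hr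
  -- integer sizes
  have hu1 : |(u : ℝ)| ≤ M := by
    have h1 : |u| ≤ |u| ^ 2 := Int.le_self_sq _
    rw [sq_abs] at h1
    have : (|u| : ℝ) ≤ (M : ℝ) := by exact_mod_cast h1.trans huM
    exact this
  have hs1 : |(s : ℝ)| ≤ N := by
    have h1 : |s| ≤ |s| ^ 2 := Int.le_self_sq _
    rw [sq_abs] at h1
    have : (|s| : ℝ) ≤ (N : ℝ) := by exact_mod_cast h1.trans hsN
    exact this
  have hvM' : |(v : ℝ)| ≤ M := by
    have h1 : |v| ≤ |v| ^ 2 := Int.le_self_sq _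
    rw [sq_abs] at h1
    have : (|v| : ℝ) ≤ (M : ℝ) := by exact_mod_cast h1.trans hvM
    exact this
  have hrN' : |(r : ℝ)| ≤ N := by
    have h1 : |r| ≤ |r| ^ 2 := Int.le_self_sq _
    rw [sq_abs] at h1
    have : (|r| : ℝ) ≤ (N : ℝ) := by exact_mod_cast h1.trans hrN
    exact this
  have hv1 : 1 ≤ |(v : ℝ)| := by rw [← Int.cast_abs]; exact_mod_cast Int.one_le_abs hv
  have hr1 : 1 ≤ |(r : ℝ)| := by rw [← Int.cast_abs]; exact_mod_cast Int.one_le_abs hr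
  have ha1 : 1 ≤ |((u * r - v * s : ℤ) : ℝ)| := by rw [← Int.cast_abs]; exact_mod_cast Int.one_le_abs ha
  have hM1 : (1 : ℝ) ≤ M := le_trans hv1 hvM'
  have hN1 : (1 : ℝ) ≤ N := le_trans hr1 hrN'
  -- the difference as a single fraction
  have hkey : (s : ℝ) / r - (u : ℝ) / v = -(((u * r - v * s : ℤ) : ℝ) / ((v : ℝ) * r)) := by
    push_cast; field_simp; ring
  have habs : |(s : ℝ) / r - (u : ℝ) / v| = |((u * r - v * s : ℤ) : ℝ)| / (|(v : ℝ)| * |(r : ℝ)|) := by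
    rw [hkey, abs_neg, abs_div, abs_mul]
  constructor
  · rw [habs]
    have hden : 0 < |(v : ℝ)| * |(r : ℝ)| := by positivity
    rw [div_le_div_iff₀ (by positivity) hden]
    calc 1 * (|(v : ℝ)| * |(r : ℝ)|) ≤ 1 * ((M : ℝ) * N) := by
          rw [one_mul, one_mul]; exact mul_le_mul hvM' hrN' (abs_nonneg _) (by positivity)
      _ ≤ |((u * r - v * s : ℤ) : ℝ)| * (2 * (M : ℝ) * N) := by
          have hMN : 0 ≤ (M : ℝ) * N := by positivity
          nlinarith [mul_le_mul_of_nonneg_right ha1 hMN]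
  · calc |(s : ℝ) / r - (u : ℝ) / v| ≤ |(s : ℝ) / r| + |(u : ℝ) / v| := abs_sub _ _
      _ ≤ |(s : ℝ)| + |(u : ℝ)| := by
          rw [abs_div, abs_div]
          exact add_le_add (div_le_self (abs_nonneg _) hr1) (div_le_self (abs_nonneg _) hv1)
      _ ≤ N + M := add_le_add hs1 hu1
      _ ≤ 2 * (M : ℝ) * N := by nlinarith

/-! ### Primary numbers: parities, the exceptional `w = 1`, vanishing for non-primitive `w` -/

/-- A primary number has odd real part and even imaginary part. [folklore] -/
private theorem odd_re_even_im_of_isPrimary {z : GaussianInt} (hz : IsPrimary z) : Odd z.re ∧ Even z.im := by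
  unfold IsPrimary at hz
  rw [Int.odd_iff, Int.even_iff]
  omega

/-- If `w` is primary and not primitive then `[wz] = 0` for every primary `z`.
[cite: FriedlanderIwaniecAnnals1998, §21 (proof of Proposition 21.4)] -/
private theorem jacobiKubota_mul_eq_zero {w z : GaussianInt} (hw : IsPrimary w) (hw' : ¬ IsPrimitive w)
    (hz : IsPrimary z) : jacobiKubota (w * z) = 0 := by
  have hwz : IsPrimary (w * z) := hw.mul hz
  refine jacobiKubota_eq_zero_of_not_isPrimitive ?_ ?_
  · intro hprim
    have hg : Int.gcd w.re w.im ≠ 1 := hw'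
    have hg0 : Int.gcd w.re w.im ≠ 0 := by
      intro h0; rw [Int.gcd_eq_zero_iff] at h0
      exact hw.ne_zero (Zsqrtd.ext h0.1 h0.2)
    have hg1 : 1 < Int.gcd w.re w.im := by omega
    have hdvd : ((Int.gcd w.re w.im : ℕ) : GaussianInt) ∣ w := by
      rw [natCast_dvd_iff]; exact ⟨Int.gcd_dvd_left _ _, Int.gcd_dvd_right _ _⟩
    exact not_natCast_dvd_of_isPrimitive hprim hg1 (hdvd.mul_right z)
  · have := re_odd_of_isPrimary hwz; omega

/-- `#{z primary : 1 ≤ |z|² ≤ N} ≤ 9N`. [folklore] -/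
private theorem card_primaryNormLE_le {N : ℕ} (hN : 1 ≤ N) : ((primaryNormLE N).card : ℝ) ≤ 9 * N := by
  have h := card_le_of_norm_le (M := N) (primaryNormLE N) fun w hw => by
    have h3 := (mem_primaryNormLE.mp hw).2.2
    have h0 := GaussianInt.abs_natCast_norm w
    have : (w.norm.natAbs : ℤ) ≤ N := by rw [h0]; exact h3
    exact_mod_cast this
  calc ((primaryNormLE N).card : ℝ) ≤ (((2 * Nat.sqrt N + 1) ^ 2 : ℕ) : ℝ) := by exact_mod_cast h
    _ ≤ 9 * N := by push_cast; exact sq_two_sqrt_add_one_le hN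

/-! ### The main range: `w` primary primitive with `v ≠ 0` -/

/-- The `w` of the main range: primary, primitive, `|w|² ≤ M`, `Im w ≠ 0` (i.e. `w ≠ 1`).
[cite: FriedlanderIwaniecAnnals1998, (21.11)] -/
private def mainW (M : ℕ) : Finset GaussianInt := (ppDisc M).filter fun w => w.im ≠ 0

/-- Membership in `mainW`. [folklore] -/
private theorem mem_mainW {M : ℕ} {w : GaussianInt} :
    w ∈ mainW M ↔ IsPrimary w ∧ IsPrimitive w ∧ w.norm ≤ M ∧ w.im ≠ 0 := by
  rw [mainW, mem_filter, mem_ppDisc]; tauto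

/-- The pair set of signs `{1, -1}²` indexing the sign classes of `(u, v)`. [folklore] -/
private def signPairs : Finset (ℤ × ℤ) := ({1, -1} : Finset ℤ) ×ˢ ({1, -1} : Finset ℤ)

/-- `#signPairs = 4`. [folklore] -/
private theorem card_signPairs : signPairs.card = 4 := by decide

/-- The sign of a nonzero integer is `1` or `-1`. [folklore] -/
private theorem sign_mem {x : ℤ} (hx : x ≠ 0) : Int.sign x ∈ ({1, -1} : Finset ℤ) := by
  rw [mem_insert, mem_singleton]
  rcases lt_or_gt_of_ne hx with h | h
  · exact Or.inr (Int.sign_eq_neg_one_iff_neg.mpr h)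
  · exact Or.inl (Int.sign_eq_one_iff_pos.mpr h)

/-- The `z`-side factor after fixing the sign class `q = (sign u, sign v)` and the value `p ∈ {0,1}`
of the threshold indicator: `[z] · epsSign q₁ q₂ (sign r) (q₂ sign r (1 - 2p))`. [folklore] -/
private def gSide (q : ℤ × ℤ) (p : ℤ) (z : GaussianInt) : ℂ :=
  jacobiKubota z * ((epsSign q.1 q.2 (Int.sign z.re) (q.2 * Int.sign z.re * (1 - 2 * p)) : ℤ) : ℂ)

/-- The `w`-side factor of the sign class `q`: `1_{(sign u, sign v) = q} [w]`. [folklore] -/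
private def fSide (q : ℤ × ℤ) (w : GaussianInt) : ℂ :=
  (if (Int.sign w.re, Int.sign w.im) = q then 1 else 0) * jacobiKubota w

/-- `‖gSide‖ ≤ 1`. [folklore] -/
private theorem norm_gSide_le (q : ℤ × ℤ) (p : ℤ) (z : GaussianInt) : ‖gSide q p z‖ ≤ 1 := by
  rw [gSide, norm_mul, norm_epsSign, mul_one]; exact norm_jacobiKubota_le_one z

/-- `‖fSide‖ ≤ 1`. [folklore] -/
private theorem norm_fSide_le (q : ℤ × ℤ) (w : GaussianInt) : ‖fSide q w‖ ≤ 1 := by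
  rw [fSide, norm_mul]
  refine mul_le_one₀ ?_ (norm_nonneg _) (norm_jacobiKubota_le_one w)
  split_ifs <;> simp

/-- The threshold functions `A(z) = s/r`, `B(w) = u/v`. [folklore] -/
private def thrA (z : GaussianInt) : ℝ := (z.im : ℝ) / z.re

/-- The threshold function `B(w) = u/v`. [folklore] -/
private def thrB (w : GaussianInt) : ℝ := (w.re : ℝ) / w.im

/-- `u/v ≠ s/r` when `ur ≠ vs` (`v, r ≠ 0`). [folklore] -/
private theorem div_ne_div_of_ne {u v r s : ℤ} (hv : v ≠ 0) (hr : r ≠ 0) (ha : u * r - v * s ≠ 0) :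
    (u : ℝ) / v ≠ (s : ℝ) / r := by
  have hv' : (v : ℝ) ≠ 0 := by exact_mod_cast hv
  have hr' : (r : ℝ) ≠ 0 := by exact_mod_cast hr
  intro h
  rw [div_eq_div_iff hv' hr'] at h
  have h' : u * r = s * v := by exact_mod_cast h
  apply ha; rw [h']; ring

/-- **The kernel identity on the main range**: for `w ∈ mainW M` and `z` primary,
`[wz] = Σ_{q ∈ {±1}²} ( fSide_q(w) gSide_{q,0}(z) [A z < B w] + fSide_q(w) gSide_{q,1}(z) [B w < A z] ) (z/w)`.
[cite: FriedlanderIwaniecAnnals1998, Lemma 20.1, (20.15)] -/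
private theorem jacobiKubota_mul_eq_sum {M : ℕ} {w z : GaussianInt} (hw : w ∈ mainW M) (hz : IsPrimary z) :
    jacobiKubota (w * z) = ∑ q ∈ signPairs,
      (fSide q w * gSide q 0 z * ((if thrA z < thrB w then (1 : ℂ) else 0) * (dirichletSym z w : ℂ)) +
        fSide q w * gSide q 1 z * ((if thrB w < thrA z then (1 : ℂ) else 0) * (dirichletSym z w : ℂ))) := by
  obtain ⟨hwp, hwq, -, hv⟩ := mem_mainW.mp hw
  obtain ⟨hro, hse⟩ := odd_re_even_im_of_isPrimary hz
  obtain ⟨huo, -⟩ := odd_re_even_im_of_isPrimary hwp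
  have hu : w.re ≠ 0 := by rintro h; rw [h] at huo; exact absurd huo (by decide)
  have hr : z.re ≠ 0 := by rintro h; rw [h] at hro; exact absurd hro (by decide)
  have ha : w.re * z.re - w.im * z.im ≠ 0 := by
    have hwz := re_odd_of_isPrimary (hwp.mul hz)
    have hre : w.re * z.re - w.im * z.im = (w * z).re := by rw [Zsqrtd.re_mul]; ring
    rw [hre]; intro h0; rw [h0] at hwz; simp at hwz
  have hmem : (Int.sign w.re, Int.sign w.im) ∈ signPairs := by
    rw [signPairs, mem_product]; exact ⟨sign_mem hu, sign_mem hv⟩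
  have hcollapse : ∀ G : ℤ × ℤ → ℂ,
      ∑ q ∈ signPairs, fSide q w * G q = jacobiKubota w * G (Int.sign w.re, Int.sign w.im) := by
    intro G
    have : ∀ q ∈ signPairs, fSide q w * G q =
        if (Int.sign w.re, Int.sign w.im) = q then jacobiKubota w * G q else 0 := by
      intro q _; rw [fSide]; split_ifs <;> ring
    rw [sum_congr rfl this, sum_ite_eq, if_pos hmem]
  have hne : thrB w ≠ thrA z := div_ne_div_of_ne hv hr ha
  rw [jacobiKubota_mul hwp hwq hro hse, kubotaEps_eq_epsSign, sign_re_mul_eq hv hr ha]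
  by_cases hlt : thrB w < thrA z
  · have hlt' : (w.re : ℝ) / w.im < (z.im : ℝ) / z.re := hlt
    have hngt : ¬ thrA z < thrB w := not_lt.mpr hlt.le
    rw [if_pos hlt']
    have : ∀ q ∈ signPairs,
        fSide q w * gSide q 0 z * ((if thrA z < thrB w then (1 : ℂ) else 0) * (dirichletSym z w : ℂ)) +
          fSide q w * gSide q 1 z * ((if thrB w < thrA z then (1 : ℂ) else 0) * (dirichletSym z w : ℂ)) =
        fSide q w * (gSide q 1 z * (dirichletSym z w : ℂ)) := by
      intro q _; rw [if_neg hngt, if_pos hlt]; ring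
    rw [sum_congr rfl this, hcollapse]
    simp only [gSide]
    ring
  · have hgt : thrA z < thrB w := lt_of_le_of_ne (not_lt.mp hlt) (Ne.symm hne)
    have hlt' : ¬ (w.re : ℝ) / w.im < (z.im : ℝ) / z.re := hlt
    rw [if_neg hlt']
    have : ∀ q ∈ signPairs,
        fSide q w * gSide q 0 z * ((if thrA z < thrB w then (1 : ℂ) else 0) * (dirichletSym z w : ℂ)) +
          fSide q w * gSide q 1 z * ((if thrB w < thrA z then (1 : ℂ) else 0) * (dirichletSym z w : ℂ)) =
        fSide q w * (gSide q 0 z * (dirichletSym z w : ℂ)) := by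
      intro q _; rw [if_pos hgt, if_neg hlt]; ring
    rw [sum_congr rfl this, hcollapse]
    simp only [gSide]
    ring

/-- **The main range**: `‖Σ_{w ∈ mainW} Σ_{z} a_w b_z [wz]‖ ≤ 8 · 3(1 + log 2MN) · X₀` whenever the
Dirichlet-symbol forms over `ppDisc M × gaussDisc N` are bounded by `X₀` (Proposition 21.3).
[cite: FriedlanderIwaniecAnnals1998, Proposition 21.4 (proof)] -/
private theorem norm_main_le {M N : ℕ} (hM : 1 ≤ M) (hN : 1 ≤ N) {X₀ : ℝ}
    (h0 : BilinBoundedBy (fun w z => (dirichletSym z w : ℂ)) (ppDisc M) (gaussDisc N) X₀)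
    (a b : GaussianInt → ℂ) (ha : ∀ w, ‖a w‖ ≤ 1) (hb : ∀ z, ‖b z‖ ≤ 1) :
    ‖∑ w ∈ mainW M, ∑ z ∈ primaryNormLE N, a w * b z * jacobiKubota (w * z)‖ ≤
      8 * (3 * (1 + Real.log (2 * (M : ℝ) * N))) * X₀ := by
  set R : ℝ := 2 * (M : ℝ) * N with hRdef
  have hM1 : (1 : ℝ) ≤ M := by exact_mod_cast hM
  have hN1 : (1 : ℝ) ≤ N := by exact_mod_cast hN
  have hR : 1 ≤ R := by rw [hRdef]; nlinarith
  -- Proposition 21.3 on the main range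
  have h1 : BilinBoundedBy (fun w z => (dirichletSym z w : ℂ)) (mainW M) (primaryNormLE N) X₀ :=
    h0.restrict (filter_subset _ _) fun z hz => mem_gaussDisc.mpr (mem_primaryNormLE.mp hz).2.2
  -- the spacing of the threshold
  have hgap' : ∀ w ∈ mainW M, ∀ z ∈ primaryNormLE N,
      1 / R ≤ |thrA z - thrB w| ∧ |thrA z - thrB w| ≤ R := by
    intro w hw z hz
    obtain ⟨hwp, -, hwM, hv⟩ := mem_mainW.mp hw
    obtain ⟨hzp, -, hzN⟩ := mem_primaryNormLE.mp hz
    obtain ⟨hro, -⟩ := odd_re_even_im_of_isPrimary hzp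
    have hr : z.re ≠ 0 := by rintro h; rw [h] at hro; exact absurd hro (by decide)
    have ha : w.re * z.re - w.im * z.im ≠ 0 := by
      have hwz := re_odd_of_isPrimary (hwp.mul hzp)
      have hre : w.re * z.re - w.im * z.im = (w * z).re := by rw [Zsqrtd.re_mul]; ring
      rw [hre]; intro h0; rw [h0] at hwz; simp at hwz
    have hnw : w.norm = w.re ^ 2 + w.im ^ 2 := by rw [Zsqrtd.norm_def]; ring
    have hnz : z.norm = z.re ^ 2 + z.im ^ 2 := by rw [Zsqrtd.norm_def]; ring
    exact threshold_gap (M := M) (N := N) hv hr ha (by nlinarith [sq_nonneg w.im]) (by nlinarith [sq_nonneg w.re])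
      (by nlinarith [sq_nonneg z.im]) (by nlinarith [sq_nonneg z.re])
  have hP := h1.threshold hR (fun w hw z hz => (hgap' w hw z hz).1) (fun w hw z hz => (hgap' w hw z hz).2)
  have hQ := h1.threshold' hR (fun w hw z hz => (hgap' w hw z hz).1) (fun w hw z hz => (hgap' w hw z hz).2)
  -- expand the kernel
  have hexp : ∑ w ∈ mainW M, ∑ z ∈ primaryNormLE N, a w * b z * jacobiKubota (w * z) =
      ∑ q ∈ signPairs,
        (∑ w ∈ mainW M, ∑ z ∈ primaryNormLE N, (a w * fSide q w) * (b z * gSide q 0 z) *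
            ((if thrA z < thrB w then (1 : ℂ) else 0) * (dirichletSym z w : ℂ)) +
          ∑ w ∈ mainW M, ∑ z ∈ primaryNormLE N, (a w * fSide q w) * (b z * gSide q 1 z) *
            ((if thrB w < thrA z then (1 : ℂ) else 0) * (dirichletSym z w : ℂ))) := by
    calc ∑ w ∈ mainW M, ∑ z ∈ primaryNormLE N, a w * b z * jacobiKubota (w * z)
        = ∑ w ∈ mainW M, ∑ z ∈ primaryNormLE N, ∑ q ∈ signPairs,
            ((a w * fSide q w) * (b z * gSide q 0 z) *
                ((if thrA z < thrB w then (1 : ℂ) else 0) * (dirichletSym z w : ℂ)) +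
              (a w * fSide q w) * (b z * gSide q 1 z) *
                ((if thrB w < thrA z then (1 : ℂ) else 0) * (dirichletSym z w : ℂ))) := by
          refine sum_congr rfl fun w hw => sum_congr rfl fun z hz => ?_
          rw [jacobiKubota_mul_eq_sum hw (mem_primaryNormLE.mp hz).1, mul_sum]
          exact sum_congr rfl fun q _ => by ring
      _ = ∑ w ∈ mainW M, ∑ q ∈ signPairs, ∑ z ∈ primaryNormLE N,
            ((a w * fSide q w) * (b z * gSide q 0 z) *
                ((if thrA z < thrB w then (1 : ℂ) else 0) * (dirichletSym z w : ℂ)) +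
              (a w * fSide q w) * (b z * gSide q 1 z) *
                ((if thrB w < thrA z then (1 : ℂ) else 0) * (dirichletSym z w : ℂ))) :=
          sum_congr rfl fun w _ => sum_comm
      _ = _ := by
          rw [sum_comm]
          refine sum_congr rfl fun q _ => ?_
          rw [← sum_add_distrib]
          exact sum_congr rfl fun w _ => sum_add_distrib
  rw [hexp]
  -- bound each of the `2 · 4` forms
  have haf : ∀ q w, ‖a w * fSide q w‖ ≤ 1 := fun q w => by
    rw [norm_mul]; exact mul_le_one₀ (ha w) (norm_nonneg _) (norm_fSide_le q w)
  have hbg : ∀ q p z, ‖b z * gSide q p z‖ ≤ 1 := fun q p z => by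
    rw [norm_mul]; exact mul_le_one₀ (hb z) (norm_nonneg _) (norm_gSide_le q p z)
  calc ‖∑ q ∈ signPairs,
        (∑ w ∈ mainW M, ∑ z ∈ primaryNormLE N, (a w * fSide q w) * (b z * gSide q 0 z) *
            ((if thrA z < thrB w then (1 : ℂ) else 0) * (dirichletSym z w : ℂ)) +
          ∑ w ∈ mainW M, ∑ z ∈ primaryNormLE N, (a w * fSide q w) * (b z * gSide q 1 z) *
            ((if thrB w < thrA z then (1 : ℂ) else 0) * (dirichletSym z w : ℂ)))‖
      ≤ ∑ q ∈ signPairs, (3 * (1 + Real.log R) * X₀ + 3 * (1 + Real.log R) * X₀) := by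
        refine (norm_sum_le _ _).trans (sum_le_sum fun q _ => (norm_add_le _ _).trans (add_le_add ?_ ?_))
        · exact hQ _ _ (haf q) (hbg q 0)
        · exact hP _ _ (haf q) (hbg q 1)
    _ = 8 * (3 * (1 + Real.log (2 * (M : ℝ) * N))) * X₀ := by
        rw [sum_const, card_signPairs, nsmul_eq_mul]; push_cast; ring

/-- **The complementary range**: among primary `w` with `|w|² ≤ M` outside `mainW M` only `w = 1`
contributes (non-primitive `w` give `[wz] = 0`), and `|Σ_z a_1 b_z [z]| ≤ #{z} ≤ 9N`.
[cite: FriedlanderIwaniecAnnals1998, Proposition 21.4 (proof)] -/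
private theorem norm_rest_le {M N : ℕ} (hN : 1 ≤ N) (a b : GaussianInt → ℂ) (ha : ∀ w, ‖a w‖ ≤ 1)
    (hb : ∀ z, ‖b z‖ ≤ 1) :
    ‖∑ w ∈ primaryNormLE M \ mainW M, ∑ z ∈ primaryNormLE N, a w * b z * jacobiKubota (w * z)‖ ≤ 9 * N := by
  set F : GaussianInt → ℂ := fun w => ∑ z ∈ primaryNormLE N, a w * b z * jacobiKubota (w * z) with hF
  have hvanish : ∀ w ∈ primaryNormLE M \ mainW M, F w = if (1 : GaussianInt) = w then F w else 0 := by
    intro w hw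
    rw [mem_sdiff, mem_primaryNormLE, mem_mainW] at hw
    obtain ⟨⟨hwp, -, hwM⟩, hnot⟩ := hw
    split_ifs with h1
    · rfl
    · -- `w ≠ 1` is not primitive (a primary primitive `w` with `Im w = 0` is `1`)
      have hnp : ¬ IsPrimitive w := by
        intro hprim
        by_cases hv : w.im = 0
        · exact h1 (eq_one_of_isPrimary_of_im_eq_zero hwp hprim hv).symm
        · exact hnot ⟨hwp, hprim, hwM, hv⟩
      rw [hF]
      exact sum_eq_zero fun z hz => by
        rw [jacobiKubota_mul_eq_zero hwp hnp (mem_primaryNormLE.mp hz).1, mul_zero]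
  have hsum : ∑ w ∈ primaryNormLE M \ mainW M, F w =
      if (1 : GaussianInt) ∈ primaryNormLE M \ mainW M then F 1 else 0 := by
    rw [sum_congr rfl hvanish, sum_ite_eq]
  have hF1 : ‖F 1‖ ≤ 9 * N := by
    rw [hF]
    calc ‖∑ z ∈ primaryNormLE N, a 1 * b z * jacobiKubota (1 * z)‖
        ≤ ∑ z ∈ primaryNormLE N, (1 : ℝ) := by
          refine (norm_sum_le _ _).trans (sum_le_sum fun z _ => ?_)
          rw [norm_mul, norm_mul]
          calc ‖a 1‖ * ‖b z‖ * ‖jacobiKubota (1 * z)‖ ≤ 1 * 1 * 1 :=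
                mul_le_mul (mul_le_mul (ha 1) (hb z) (norm_nonneg _) zero_le_one)
                  (norm_jacobiKubota_le_one _) (norm_nonneg _) (by norm_num)
            _ = 1 := by ring
      _ = (primaryNormLE N).card := by simp
      _ ≤ 9 * N := card_primaryNormLE_le hN
  change ‖∑ w ∈ primaryNormLE M \ mainW M, F w‖ ≤ 9 * N
  rw [hsum]
  split_ifs
  · exact hF1
  · rw [norm_zero]; positivity

/-! ### Proposition 21.4 -/

/-- **Friedlander–Iwaniec, Proposition 21.4 (21.13)** (for `𝒦(M, N)`): for every `ε > 0` there is
`C = C(ε)` such that for all `M, N ≥ 1` and all coefficients `|α_w|, |β_z| ≤ 1`,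
`|Σ_w Σ_z α_w β_z [wz]| ≤ C (M + N)^{1/12} (MN)^{11/12 + ε}`, the sums over primary `w`, `z` with
`1 ≤ |w|² ≤ M`, `1 ≤ |z|² ≤ N` and `[·]` the Jacobi–Kubota symbol (20.1).
[cite: FriedlanderIwaniecAnnals1998, Proposition 21.4 (21.13)] -/
theorem norm_kubotaBilin_le {ε : ℝ} (hε : 0 < ε) :
    ∃ C : ℝ, 0 < C ∧ ∀ M N : ℕ, 1 ≤ M → 1 ≤ N → ∀ α β : GaussianInt → ℂ,
      (∀ w, ‖α w‖ ≤ 1) → (∀ z, ‖β z‖ ≤ 1) →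
        ‖∑ w ∈ primaryNormLE M, ∑ z ∈ primaryNormLE N, α w * β z * jacobiKubota (w * z)‖ ≤
          C * ((M : ℝ) + N) ^ (1 / 12 : ℝ) * ((M : ℝ) * N) ^ (11 / 12 + ε) := by
  have hε2 : 0 < ε / 2 := by linarith
  obtain ⟨C₀, hC₀, h0⟩ := bilinBoundedBy_dirichletSym hε2
  refine ⟨24 * (2 + 2 / ε) * C₀ + 9, by positivity, ?_⟩
  intro M N hM hN α β hα hβ
  have hM1 : (1 : ℝ) ≤ M := by exact_mod_cast hM
  have hN1 : (1 : ℝ) ≤ N := by exact_mod_cast hN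
  have hM0 : (0 : ℝ) < M := by linarith
  have hN0 : (0 : ℝ) < N := by linarith
  have hMN1 : (1 : ℝ) ≤ (M : ℝ) * N := by nlinarith
  -- split `w`
  have hsub : mainW M ⊆ primaryNormLE M := by
    intro w hw
    obtain ⟨hwp, -, hwM, -⟩ := mem_mainW.mp hw
    exact mem_primaryNormLE.mpr ⟨hwp, GaussianInt.norm_pos.mpr hwp.ne_zero, hwM⟩
  rw [← sum_sdiff hsub]
  have hrest := norm_rest_le (M := M) hN α β hα hβ
  have hmain := norm_main_le hM hN (h0 M N hM hN) α β hα hβ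
  -- numerics
  set P : ℝ := ((M : ℝ) + N) ^ (1 / 12 : ℝ) with hP
  have hP0 : 0 < P := by positivity
  have hlog : 1 + Real.log (2 * (M : ℝ) * N) ≤ (2 + 2 / ε) * ((M : ℝ) * N) ^ (ε / 2) := by
    have h2 : Real.log (2 * (M : ℝ) * N) = Real.log 2 + Real.log ((M : ℝ) * N) := by
      rw [mul_assoc, Real.log_mul (by norm_num) (by positivity)]
    have hl2 := Real.log_two_lt_d9
    have hl := Real.log_le_rpow_div (by positivity : (0 : ℝ) ≤ (M : ℝ) * N) hε2
    have hpow1 : (1 : ℝ) ≤ ((M : ℝ) * N) ^ (ε / 2) := Real.one_le_rpow hMN1 hε2.le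
    rw [h2]
    have : Real.log ((M : ℝ) * N) ≤ 2 / ε * ((M : ℝ) * N) ^ (ε / 2) :=
      calc Real.log ((M : ℝ) * N) ≤ ((M : ℝ) * N) ^ (ε / 2) / (ε / 2) := hl
        _ = 2 / ε * ((M : ℝ) * N) ^ (ε / 2) := by rw [div_div_eq_mul_div]; ring
    have h3 : 0 ≤ 2 / ε * ((M : ℝ) * N) ^ (ε / 2) := by positivity
    nlinarith
  have hmain' : ‖∑ w ∈ mainW M, ∑ z ∈ primaryNormLE N, α w * β z * jacobiKubota (w * z)‖ ≤
      24 * (2 + 2 / ε) * C₀ * P * ((M : ℝ) * N) ^ (11 / 12 + ε) := by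
    refine hmain.trans ?_
    have hsplit : ((M : ℝ) * N) ^ (11 / 12 + ε) = ((M : ℝ) * N) ^ (ε / 2) * ((M : ℝ) * N) ^ (11 / 12 + ε / 2) := by
      rw [← Real.rpow_add (by positivity)]; ring_nf
    rw [hsplit]
    have hX0 : 0 ≤ C₀ * P * ((M : ℝ) * N) ^ (11 / 12 + ε / 2) := by positivity
    calc 8 * (3 * (1 + Real.log (2 * (M : ℝ) * N))) * (C₀ * ((M : ℝ) + N) ^ (1 / 12 : ℝ) * ((M : ℝ) * N) ^ (11 / 12 + ε / 2))
        = 24 * (1 + Real.log (2 * (M : ℝ) * N)) * (C₀ * P * ((M : ℝ) * N) ^ (11 / 12 + ε / 2)) := by rw [hP]; ring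
      _ ≤ 24 * ((2 + 2 / ε) * ((M : ℝ) * N) ^ (ε / 2)) * (C₀ * P * ((M : ℝ) * N) ^ (11 / 12 + ε / 2)) :=
          mul_le_mul_of_nonneg_right (mul_le_mul_of_nonneg_left hlog (by norm_num)) hX0
      _ = 24 * (2 + 2 / ε) * C₀ * P * (((M : ℝ) * N) ^ (ε / 2) * ((M : ℝ) * N) ^ (11 / 12 + ε / 2)) := by ring
  have hrest' : ‖∑ w ∈ primaryNormLE M \ mainW M, ∑ z ∈ primaryNormLE N, α w * β z * jacobiKubota (w * z)‖ ≤
      9 * P * ((M : ℝ) * N) ^ (11 / 12 + ε) := by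
    refine hrest.trans ?_
    have h1 : (N : ℝ) = (N : ℝ) ^ (1 / 12 : ℝ) * (N : ℝ) ^ (11 / 12 : ℝ) := by
      rw [← Real.rpow_add hN0]; norm_num
    have h2 : (N : ℝ) ^ (1 / 12 : ℝ) ≤ P := Real.rpow_le_rpow hN0.le (by linarith) (by norm_num)
    have h3 : (N : ℝ) ^ (11 / 12 : ℝ) ≤ ((M : ℝ) * N) ^ (11 / 12 + ε) :=
      calc (N : ℝ) ^ (11 / 12 : ℝ) ≤ ((M : ℝ) * N) ^ (11 / 12 : ℝ) :=
            Real.rpow_le_rpow hN0.le (by nlinarith) (by norm_num)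
        _ ≤ ((M : ℝ) * N) ^ (11 / 12 + ε) := Real.rpow_le_rpow_of_exponent_le hMN1 (by linarith)
    calc (9 : ℝ) * N = 9 * ((N : ℝ) ^ (1 / 12 : ℝ) * (N : ℝ) ^ (11 / 12 : ℝ)) := by rw [← h1]
      _ ≤ 9 * (P * ((M : ℝ) * N) ^ (11 / 12 + ε)) :=
          mul_le_mul_of_nonneg_left (mul_le_mul h2 h3 (by positivity) hP0.le) (by norm_num)
      _ = 9 * P * ((M : ℝ) * N) ^ (11 / 12 + ε) := by ring
  calc ‖∑ w ∈ primaryNormLE M \ mainW M, ∑ z ∈ primaryNormLE N, α w * β z * jacobiKubota (w * z) +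
        ∑ w ∈ mainW M, ∑ z ∈ primaryNormLE N, α w * β z * jacobiKubota (w * z)‖
      ≤ 9 * P * ((M : ℝ) * N) ^ (11 / 12 + ε) + 24 * (2 + 2 / ε) * C₀ * P * ((M : ℝ) * N) ^ (11 / 12 + ε) :=
        (norm_add_le _ _).trans (add_le_add hrest' hmain')
    _ = (24 * (2 + 2 / ε) * C₀ + 9) * P * ((M : ℝ) * N) ^ (11 / 12 + ε) := by ring

end Literature.NumberTheory.Sieve.FriedlanderIwaniecPrimes
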